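import Literature.NumberTheory.Transcendental.RoySmallValueBasic
import Mathlib.Algebra.MvPolynomial.NoZeroDivisors
import Mathlib.RingTheory.Polynomial.UniqueFactorization
import Mathlib.RingTheory.UniqueFactorizationDomain.Multiplicity
import HarnessLib

/-!
# Roy's small value estimate for `𝔾ₐ × 𝔾ₘ` — §5 algebra of `𝒟`: Lemma 5.3 (eigenvectors of `𝒟`)

Topic `Literature/NumberTheory/Transcendental`. Part of the formalisation of the proof of Roy 2013,
Theorem 1.1 (named fact `roy2013_thm_1_1`, `RoySmallValueEstimates.lean`). Source: D. Roy,
*A small value estimate for `𝔾ₐ × 𝔾ₘ`*, Mathematika 59 (2013) 333–363 = arXiv:1301.0663, §5,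
Lemmas 5.3 and 5.4 (p. 14 of the arXiv text):

> **Lemma 5.3.** Let `R` be an irreducible homogeneous polynomial of `ℚ[X]`. Then `R` divides
> `𝒟R` if and only if `R` is a constant multiple of either `X₀` or `X₂`.
> **Lemma 5.4.** Let `P ∈ ℚ[X]_D` with `X₀ ∤ P` and `X₂ ∤ P`. If an irreducible homogeneous
> `R ∈ ℚ[X]` divides `P, 𝒟P, …, 𝒟ᵏP` for some `k ≥ 0`, then `R^{k+1}` divides `P`. In
> particular `P, 𝒟P, …, 𝒟^D P` have no common irreducible factor in `ℚ[X]`.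

These are statements over `ℚ` (they are applied to integer polynomials in §§6–7), so we first set
up `𝒟 = X₀∂/∂X₁ + X₂∂/∂X₂` over an arbitrary commutative ring `K` — `homDK K` (with
`homDK ℂ = homD` definitionally, `homDK_complex`) — and prove both lemmas over any field of
characteristic zero:

* `eq_monomial_of_homDK_eq_smul` — an eigenvector `𝒟R = λR` in `K[X]_d` is a monomial
  `c X₀^a X₂^b` (Roy: the eigenvalues of `𝒟` on `ℚ[X]_D` are `0, …, D` with eigenvectors
  `X₂^k X₀^{D-k}`; here by the coefficient recursion
  `λ r_μ = μ₂ r_μ + (μ₁+1) r_{μ - e₀ + e₁}`);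
* `lemma_5_3` — the forward implication of Lemma 5.3 in the form used later: an irreducible
  homogeneous `R` dividing `𝒟R` is associated to `X₀` or to `X₂` (the converse is
  `homDK_X_zero`, `homDK_X_two`).

Lemma 5.4 is in the sequel. One definition (`homDK`), everything proved, no new named facts.

## References

* [Roy2013] D. Roy, *A small value estimate for 𝔾ₐ × 𝔾ₘ*, Mathematika 59 (2013), 333–363
  (arXiv:1301.0663), §5, Lemmas 5.3, 5.4.
-/

noncomputable section

open MvPolynomial Finset

namespace Literature.NumberTheory.Transcendental

namespace Roy2013

/-! ### `𝒟` over a general base ring -/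

/-- Roy's derivation `𝒟 = X₀ ∂/∂X₁ + X₂ ∂/∂X₂` of `K[X₀, X₁, X₂]` over any commutative ring `K`
(`homD` is the case `K = ℂ`). [cite: Roy2013, §3 (p. 8)] -/
def homDK (K : Type*) [CommRing K] :
    Derivation K (MvPolynomial (Fin 3) K) (MvPolynomial (Fin 3) K) :=
  (X 0 : MvPolynomial (Fin 3) K) • pderiv 1 + (X 2 : MvPolynomial (Fin 3) K) • pderiv 2

/-- `homDK ℂ` is `homD`. [folklore] -/
theorem homDK_complex : homDK ℂ = homD := rfl

section General

variable {K : Type*} [CommRing K]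

/-- `𝒟 P = X₀ ∂P/∂X₁ + X₂ ∂P/∂X₂`. [cite: Roy2013, §3 (p. 8)] -/
theorem homDK_apply (P : MvPolynomial (Fin 3) K) :
    homDK K P = X 0 * pderiv 1 P + X 2 * pderiv 2 P := by
  simp only [homDK, Derivation.coe_add, Derivation.coe_smul, Pi.add_apply, Pi.smul_apply,
    smul_eq_mul]

/-- `𝒟 X₀ = 0`. [cite: Roy2013, §3 (p. 8)] -/
@[simp] theorem homDK_X_zero : homDK K (X 0) = 0 := by
  rw [homDK_apply, pderiv_X_of_ne (by decide), pderiv_X_of_ne (by decide), mul_zero, mul_zero,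
    add_zero]

/-- `𝒟 X₁ = X₀`. [cite: Roy2013, §3 (p. 8)] -/
@[simp] theorem homDK_X_one : homDK K (X 1) = X 0 := by
  rw [homDK_apply, pderiv_X_self, pderiv_X_of_ne (by decide), mul_one, mul_zero, add_zero]

/-- `𝒟 X₂ = X₂`. [cite: Roy2013, §3 (p. 8)] -/
@[simp] theorem homDK_X_two : homDK K (X 2) = X 2 := by
  rw [homDK_apply, pderiv_X_of_ne (by decide), pderiv_X_self, mul_zero, mul_one, zero_add]

/-- `𝒟` kills constants. [folklore] -/
@[simp] theorem homDK_C (a : K) : homDK K (C a) = 0 := by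
  rw [homDK_apply, pderiv_C, pderiv_C, mul_zero, mul_zero, add_zero]

/-- **Coefficients of `𝒟R`**: `[X^μ] 𝒟R = [μ₀ ≥ 1] (μ₁+1) [X^{μ-e₀+e₁}] R + μ₂ [X^μ] R`.
[cite: Roy2013, §5, proof of Lemma 5.3] -/
theorem coeff_homDK (R : MvPolynomial (Fin 3) K) (μ : Fin 3 →₀ ℕ) :
    coeff μ (homDK K R) =
      (if μ 0 = 0 then 0 else
        (μ 1 + 1 : ℕ) * coeff (μ - Finsupp.single 0 1 + Finsupp.single 1 1) R) +
        (μ 2 : ℕ) * coeff μ R := by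
  classical
  rw [homDK_apply, coeff_add, coeff_X_mul', coeff_X_mul']
  congr 1
  · simp only [Finsupp.mem_support_iff, ne_eq, ite_not]
    split_ifs with h
    · rfl
    · have h1 : (μ - Finsupp.single 0 1 : Fin 3 →₀ ℕ) 1 + 1 = μ 1 + 1 := by simp
      rw [coeff_pderiv, mul_comm, ← Nat.cast_add_one, h1]
  · simp only [Finsupp.mem_support_iff, ne_eq, ite_not]
    split_ifs with h
    · rw [h, Nat.cast_zero, zero_mul]
    · have h2 : (μ - Finsupp.single 2 1 : Fin 3 →₀ ℕ) 2 + 1 = μ 2 := by simp; omega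
      rw [coeff_pderiv, mul_comm, tsub_add_cancel_of_le (Finsupp.single_le_iff.mpr
        (Nat.one_le_iff_ne_zero.mpr h)), ← Nat.cast_add_one, h2]

/-- `𝒟` maps `K[X]_d` to itself. [cite: Roy2013, §3 (p. 8)] -/
theorem isHomogeneous_homDK {P : MvPolynomial (Fin 3) K} {d : ℕ} (hP : P.IsHomogeneous d) :
    (homDK K P).IsHomogeneous d := by
  rcases Nat.eq_zero_or_pos d with rfl | hd
  · rw [← totalDegree_zero_iff_isHomogeneous, totalDegree_eq_zero_iff_eq_C] at hP
    rw [hP, homDK_C]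
    exact isHomogeneous_zero _ _ _
  · rw [homDK_apply]
    have h1 := (isHomogeneous_X K (0 : Fin 3)).mul (hP.pderiv (i := 1))
    have h2 := (isHomogeneous_X K (2 : Fin 3)).mul (hP.pderiv (i := 2))
    rw [show 1 + (d - 1) = d by omega] at h1 h2
    exact h1.add h2

end General

/-! ### Eigenvectors of `𝒟` (Lemma 5.3) -/

section Field

variable {K : Type*} [Field K] [CharZero K]

/-- **No `X₁` in an eigenvector**: if `𝒟R = λR` then no monomial of `R` involves `X₁`
(take a monomial of `R` with `X₁`-exponent `μ₁ ≥ 1` maximal: the recursion at `μ` gives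
`λ = μ₂`, and at `μ + e₀ - e₁` it gives `μ₁ r_μ = 0`). [cite: Roy2013, §5, proof of Lemma 5.3] -/
theorem coeff_eq_zero_of_homDK_eq_smul {R : MvPolynomial (Fin 3) K} {c : K}
    (hR : homDK K R = c • R) {μ : Fin 3 →₀ ℕ} (hμ : 1 ≤ μ 1) : coeff μ R = 0 := by
  classical
  by_contra hne
  -- a monomial with `X₁` and maximal `X₁`-exponent
  set S := R.support.filter (fun ν => 1 ≤ ν 1) with hS
  have hSne : S.Nonempty := ⟨μ, by rw [hS, mem_filter, mem_support_iff]; exact ⟨hne, hμ⟩⟩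
  obtain ⟨ν, hνS, hνmax⟩ := S.exists_max_image (fun ν => ν 1) hSne
  rw [hS, mem_filter, mem_support_iff] at hνS
  obtain ⟨hν0, hν1⟩ := hνS
  have hrel : ∀ θ : Fin 3 →₀ ℕ, c * coeff θ R =
      (if θ 0 = 0 then 0 else
        (θ 1 + 1 : ℕ) * coeff (θ - Finsupp.single 0 1 + Finsupp.single 1 1) R) +
        (θ 2 : ℕ) * coeff θ R := by
    intro θ
    have := congr_arg (coeff θ) hR
    rwa [coeff_homDK, coeff_smul, smul_eq_mul, eq_comm] at this
  -- at `ν`: the shifted monomial has larger `X₁`-exponent, so its coefficient vanishes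
  have hup : coeff (ν - Finsupp.single 0 1 + Finsupp.single 1 1) R = 0 := by
    by_contra h'
    have hmem : ν - Finsupp.single 0 1 + Finsupp.single 1 1 ∈ S := by
      rw [hS, mem_filter, mem_support_iff]
      exact ⟨h', by simp⟩
    have := hνmax _ hmem
    simp at this
  have hc : c = (ν 2 : ℕ) := by
    have h := hrel ν
    rw [hup, mul_zero, ite_self, zero_add] at h
    exact mul_right_cancel₀ hν0 h
  -- at `ν + e₀ - e₁`
  set θ : Fin 3 →₀ ℕ := ν + Finsupp.single 0 1 - Finsupp.single 1 1 with hθ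
  have hθ0 : θ 0 ≠ 0 := by simp [hθ]
  have hθ2 : θ 2 = ν 2 := by simp [hθ]
  have hθ1 : θ 1 + 1 = ν 1 := by simp [hθ]; omega
  have hθs : θ - Finsupp.single 0 1 + Finsupp.single 1 1 = ν := by
    ext i
    fin_cases i
    · simp [hθ]
    · simp [hθ]; omega
    · simp [hθ]
  have h := hrel θ
  rw [if_neg hθ0, hθs, hθ1, hθ2, ← hc, add_comm, left_eq_add] at h
  rcases mul_eq_zero.mp h with h1 | h1
  · exact absurd h1 (Nat.cast_ne_zero.mpr (by omega))
  · exact hν0 h1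

/-- **An eigenvector of `𝒟` in `K[X]_d` is a monomial `c X₀^a X₂^b`.**
[cite: Roy2013, §5, proof of Lemma 5.3] -/
theorem eq_monomial_of_homDK_eq_smul {R : MvPolynomial (Fin 3) K} {c : K} {d : ℕ}
    (hRd : R.IsHomogeneous d) (hR : homDK K R = c • R) (hR0 : R ≠ 0) :
    ∃ (a : K) (k : ℕ), k ≤ d ∧ R = C a * X 0 ^ (d - k) * X 2 ^ k := by
  classical
  have hX1 : ∀ μ ∈ R.support, μ 1 = 0 := fun μ hμ => by
    by_contra h
    exact (mem_support_iff.mp hμ) (coeff_eq_zero_of_homDK_eq_smul hR (Nat.one_le_iff_ne_zero.mpr h))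
  -- every monomial has `X₂`-exponent `c`
  have hX2 : ∀ μ ∈ R.support, (μ 2 : K) = c := by
    intro μ hμ
    have h := congr_arg (coeff μ) hR
    rw [coeff_homDK, coeff_smul, smul_eq_mul] at h
    have hup : coeff (μ - Finsupp.single 0 1 + Finsupp.single 1 1) R = 0 :=
      coeff_eq_zero_of_homDK_eq_smul hR (by simp)
    rw [hup, mul_zero, ite_self, zero_add] at h
    exact mul_right_cancel₀ (mem_support_iff.mp hμ) h
  -- hence the support is a single exponent
  obtain ⟨μ, hμ⟩ : R.support.Nonempty := support_nonempty.mpr hR0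
  have hdeg : ∀ ν ∈ R.support, ν 0 + ν 1 + ν 2 = d := fun ν hν => by
    have h : ν.degree = d := by
      rw [Finsupp.degree_eq_weight_one]; exact hRd (mem_support_iff.mp hν)
    rwa [Finsupp.degree_eq_sum, Fin.sum_univ_three] at h
  have hsupp : ∀ ν ∈ R.support, ν = μ := by
    intro ν hν
    have h2 : ν 2 = μ 2 := by exact_mod_cast (hX2 ν hν).trans (hX2 μ hμ).symm
    have h1 := hX1 ν hν
    have h1' := hX1 μ hμ
    have hd := hdeg ν hν
    have hd' := hdeg μ hμ
    ext i; fin_cases i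
    · show ν 0 = μ 0; omega
    · show ν 1 = μ 1; omega
    · exact h2
  refine ⟨coeff μ R, μ 2, by have := hdeg μ hμ; omega, ?_⟩
  have hμeq : μ = Finsupp.single 0 (d - μ 2) + Finsupp.single 2 (μ 2) := by
    have h1 := hX1 μ hμ
    have hd := hdeg μ hμ
    ext i; fin_cases i
    · simp; omega
    · simp [h1]
    · simp
  calc R = monomial μ (coeff μ R) := by
        conv_lhs => rw [R.as_sum, Finset.sum_eq_single_of_mem μ hμ (fun ν hν hne => absurd
          (hsupp ν hν) hne)]
    _ = C (coeff μ R) * X 0 ^ (d - μ 2) * X 2 ^ (μ 2) := by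
        rw [C_mul_X_pow_eq_monomial, X_pow_eq_monomial, monomial_mul, mul_one, ← hμeq]

omit [CharZero K] in
/-- If a homogeneous `R ≠ 0` divides `𝒟R` then `𝒟R = λR` for a constant `λ` (degrees).
[cite: Roy2013, §5, proof of Lemma 5.3] -/
theorem homDK_eq_smul_of_dvd {R : MvPolynomial (Fin 3) K} {d : ℕ} (hRd : R.IsHomogeneous d)
    (hR0 : R ≠ 0) (hdvd : R ∣ homDK K R) : ∃ c : K, homDK K R = c • R := by
  obtain ⟨A, hA⟩ := hdvd
  by_cases hDR : homDK K R = 0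
  · exact ⟨0, by rw [hDR, zero_smul]⟩
  · have hA0 : A ≠ 0 := by rintro rfl; exact hDR (by rw [hA, mul_zero])
    have hdeg := totalDegree_mul_of_isDomain hR0 hA0
    rw [← hA, (isHomogeneous_homDK hRd).totalDegree hDR, hRd.totalDegree hR0] at hdeg
    have hA' : A.totalDegree = 0 := by omega
    rw [totalDegree_eq_zero_iff_eq_C] at hA'
    refine ⟨coeff 0 A, ?_⟩
    rw [hA]
    conv_lhs => rw [hA']
    rw [smul_eq_C_mul, mul_comm]

/-- **Roy 2013, Lemma 5.3** (the implication used later): an irreducible homogeneous `R ∈ K[X]`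
dividing `𝒟R` is associated to `X₀` or to `X₂` (`K` a field of characteristic `0`; the converse
is `𝒟X₀ = 0`, `𝒟X₂ = X₂`). [cite: Roy2013, Lemma 5.3] -/
theorem lemma_5_3 {R : MvPolynomial (Fin 3) K} {d : ℕ} (hRd : R.IsHomogeneous d)
    (hirr : Irreducible R) (hdvd : R ∣ homDK K R) : Associated R (X 0) ∨ Associated R (X 2) := by
  obtain ⟨c, hc⟩ := homDK_eq_smul_of_dvd hRd hirr.ne_zero hdvd
  obtain ⟨a, k, hk, hR⟩ := eq_monomial_of_homDK_eq_smul hRd hc hirr.ne_zero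
  have ha : a ≠ 0 := by rintro rfl; exact hirr.ne_zero (by rw [hR, C_0, zero_mul, zero_mul])
  have haU : IsUnit (C a : MvPolynomial (Fin 3) K) := (isUnit_iff_ne_zero.mpr ha).map C
  -- monomials of positive degree are not units
  have hnu : ∀ i j : ℕ, 1 ≤ i + j → ¬IsUnit (C a * X 0 ^ i * X 2 ^ j : MvPolynomial (Fin 3) K) := by
    intro i j hij hu
    rw [isUnit_iff_totalDegree_of_isReduced] at hu
    have hh : (C a * X 0 ^ i * X 2 ^ j : MvPolynomial (Fin 3) K).IsHomogeneous (0 + i + j) :=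
      ((isHomogeneous_C _ a).mul (isHomogeneous_X_pow (R := K) (0 : Fin 3) i)).mul
        (isHomogeneous_X_pow (R := K) (2 : Fin 3) j)
    have hne : (C a * X 0 ^ i * X 2 ^ j : MvPolynomial (Fin 3) K) ≠ 0 :=
      mul_ne_zero (mul_ne_zero (by rwa [Ne, C_eq_zero]) (pow_ne_zero _ (X_ne_zero _)))
        (pow_ne_zero _ (X_ne_zero _))
    have := hh.totalDegree hne
    omega
  have hXnu : ∀ s : Fin 3, ¬IsUnit (X s : MvPolynomial (Fin 3) K) := fun s hu => by
    rw [isUnit_iff_totalDegree_of_isReduced, totalDegree_X] at hu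
    exact one_ne_zero hu.2
  -- `d = 1`
  rcases Nat.lt_or_ge d 2 with hd | hd
  · interval_cases d
    · -- `d = 0`: `R = C a` is a unit
      have hk0 : k = 0 := by omega
      rw [hk0, pow_zero, pow_zero, mul_one, mul_one] at hR
      exact absurd (hR ▸ haU) hirr.not_isUnit
    · interval_cases k
      · left
        rw [hR, Nat.sub_zero, pow_one, pow_zero, mul_one]
        exact associated_unit_mul_left _ _ haU
      · right
        rw [hR, Nat.sub_self, pow_zero, mul_one, pow_one]
        exact associated_unit_mul_left _ _ haU
  · exfalso
    rcases Nat.eq_zero_or_pos k with hk0 | hk0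
    · have hfac : R = (C a * X 0 ^ (d - 1) * X 2 ^ 0) * X 0 := by
        rw [hR, hk0, Nat.sub_zero, pow_zero, mul_one, mul_one, mul_assoc, ← pow_succ,
          Nat.sub_add_cancel (by omega)]
      rcases hirr.isUnit_or_isUnit hfac with h | h
      · exact hnu _ _ (by omega) h
      · exact hXnu 0 h
    · have hfac : R = (C a * X 0 ^ (d - k) * X 2 ^ (k - 1)) * X 2 := by
        rw [hR, mul_assoc (C a * X 0 ^ (d - k)), ← pow_succ, Nat.sub_add_cancel hk0]
      rcases hirr.isUnit_or_isUnit hfac with h | h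
      · exact hnu _ _ (by omega) h
      · exact hXnu 2 h

end Field

end Roy2013

end Literature.NumberTheory.Transcendental
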